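import Summits.QuantumFields.YangMills.Theorems.FluctuationComparisonRegPrIntLS2BetaCriticalOrbitUniqueAbelian
import Summits.QuantumFields.YangMills.Theorems.FluctuationComparisonRegPrIntLS2BetaCentralStabOfIrr
import Summits.QuantumFields.YangMills.Theorems.UnitScaleTiltProp7SymCentreCentralGauge
import Summits.QuantumFields.YangMills.Theorems.UnitScaleTiltProp7FlatRigidity
import Summits.QuantumFields.YangMills.Theorems.UnitScaleTiltProp7OrbitTransport
import Summits.QuantumFields.YangMills.Theorems.UnitScaleTiltProp7NestedMeanParallelLiftParSplit
import HarnessLib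

/-!
# S2β · [Balaban1985Variational] PROP. 7 CLAUSE 1 AT EVERY DATUM, `L ≥ 5`, MODULO THE ONE ABELIAN LETTER EX^{ab}: the three strata
# (irreducible ✓, central-holonomy — HERE, unconditionally —, abelian ⟸ EX^{ab}) and the re-gauging between them

Cell `ym3-torus` (YM ladder rung R3 = continuum `SU(2)` Yang–Mills on the three-torus at fixed lattice data — a RUNG: NOT d = 4, NOT infinite volume,
NOT a mass gap, NOT Clay).  Width seat `ym3-torus-px12` (gen 21), pen (B) «ABELIAN STRATUM» FILE 4; crux `stmt-QuantumFields-20520`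
(`…Theses.UnitScaleTilt.FluctuationComparisonRegPrIntL`), LINE S2β; `--kind proof --supports stmt-QuantumFields-20520 --as helper`: count-neutral, DEFINITION-FREE
(0 `def`, 0 `instance`, 0 `notation`, 0 `sorry`, default heartbeats).

WHY.  The tree's stratification of coarse `SU(2)` data (19200 SYM-CENTRE line): ✓`onlyScalar_or_exists_gauge_commute_sigma3` — EITHER every `V♭`-parallel matrix
section is a scalar (the irreducible datum; there Prop. 7 cl. 1 is ✓px21 `atMostOneCriticalOrbit_of_irr_five` ∘ ✓pen 4) OR `V` is gauge-equivalent to a σ₃-DIAGONAL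
datum; for a diagonal datum ✓`parallelConstDiag_or_loopHol_central` — EITHER case A (every parallel section a constant diagonal: the genuinely abelian datum; Prop. 7
cl. 1 ⟸ EX^{ab} by ✓FILE 3 `atMostOneCriticalOrbit_of_abelianMin_caseA_five`) OR case B (every closed-walk holonomy at some site is central).  THIS FILE settles case B
UNCONDITIONALLY — the Z2 normal form ✓`exists_gauge_centralValued_of_loopHol_central` makes `V = w • S` with `S` central-valued; the block-constant section ✓`secTo S`
lies in the fibre of `S` and in (6)(a) at EVERY radius `a > 0` (✓`secTo_mem_regFibrePr_of_central`), so its plaquette variables are all `1`, it is holonomy-flat, and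
✓`Prop7FlatRigidity.atMostOneCriticalOrbit_of_holFlat_mem_fibre` applies at `S`; ✓`Prop7OrbitTransport.atMostOneCriticalOrbit_gaugeAct` moves the clause along
`w = (liftTransfTo w)↓` — and assembles the MASTER door: Prop. 7 cl. 1 at EVERY `2`-small datum, `L ≥ 5`, modulo EX^{ab} at the diagonal representative.

WHAT.
* §1 `plaqHol_secTo_eq_one_of_central`, ★★`atMostOneCriticalOrbit_of_centralValued`, ★★★`atMostOneCriticalOrbit_of_loopHol_central` — case B, NO hypothesis beyond
  `PlaqSmall δ V`, `δ ≤ 2`, every `ε₀`, every member, every `L`.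
* §2 `irr_of_onlyScalar` — the SYM-CENTRE «only scalar parallel sections» letter ⇒ (T7b)'s IRR(V) letter.
* §3 ★★★★`atMostOneCriticalOrbit_five_of_exab (L) (h5 : 5 ≤ L)` — `∃ e₉ > 0`: for every member, heights `n < K`, admissible `0 < e ≤ e₉`, every datum `V` with
  `PlaqSmall δ V` (`δ ≤ 2`): IF for every coarse gauge `g` making `g • V` σ₃-diagonal of case A an abelian constrained minimiser over `g • V` is supplied (EX^{ab},
  DISPLAYED, the ONLY letter), THEN `(varProblem3 F n K hnK.le).AtMostOneCriticalOrbit e V`.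

HONEST.  EX^{ab} (existence of a σ₃-diagonal constrained minimiser of the regular fibre over a case-A diagonal datum, with its lettering and loop-sum guards) is NOT
proved — it is the abelian (U(1), linear-constraint) problem's content; nothing of Bałaban's analysis is asserted beyond the cited tree theorems; the window schema
`Prop7AtMostOneCriticalOrbitAt L a₀ B₃` is NOT claimed (it quantifies `PlaqSmall ε₁` data for every `ε₁`, and carries `e` up to `a₀`); (E), ISOL∘, TUBE-REG∘, GAP♯∘,
EXW∘, S2β and crux 20520 are NOT proved; at `L = 3` the Thm-2 socket is open (EMBARGO-LITE №58); rung R3 = `YM3TorusSU2` as filed — SU(2) YM₃ on T³; the Yang–Mills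
mass gap is NOT proved.  Sorry-free, axioms standard.
[cite: Balaban1985Variational, (2)-(7) p.278, Prop. 7 p.299; Balaban1985BackgroundPropagators, (3.21) p.394; Balaban1985Averaging, (8)-(13) p.19, (19)-(20) p.21; Balaban1987RG1, (0.4)+(0.11) p.253]
-/

set_option autoImplicit false

noncomputable section

open scoped Matrix.Norms.L2Operator
open Literature.MathematicalPhysics.QuantumFieldTheory.Balaban1983to89
open Literature.MathematicalPhysics.QuantumFieldTheory.Balaban1983to89.T4Continuum
open Literature.MathematicalPhysics.QuantumFieldTheory.Balaban1983to89.BlockAveraging (Idx)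
open Literature.MathematicalPhysics.QuantumFieldTheory.Balaban1983to89.ExpMeanLog (expMeanLogSU deltaSU)
open Literature.MathematicalPhysics.QuantumFieldTheory.Balaban1983to89.B9AdOrthogonal (σ₃)
open Literature.MathematicalPhysics.QuantumFieldTheory.Balaban1983to89.B10Eq27TorusAxialLog (unitsField toUField)
open Literature.MathematicalPhysics.QuantumFieldTheory.Balaban1983to89.T3ContinuumYM3Torus
open Literature.MathematicalPhysics.QuantumFieldTheory.Balaban1983to89.T3UnitLawDensityEML (ℰp)
open Literature.MathematicalPhysics.QuantumFieldTheory.Balaban1983to89.T3TiltDescent (descendTo)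
open Literature.MathematicalPhysics.QuantumFieldTheory.Balaban1983to89.T3ConstrainedMinimiser (fibre)
open Literature.MathematicalPhysics.QuantumFieldTheory.Balaban1983to89.T3PrintedRegularMinimiser
open Literature.MathematicalPhysics.QuantumFieldTheory.Balaban1983to89.T3RegularMinimiser (regThreshold regThreshold_pos)
open Literature.MathematicalPhysics.QuantumFieldTheory.Balaban1983to89.T3PrintedRegularOrbits (descTransf liftTransfTo descTransf_liftTransfTo plaqSmall_gaugeAct_iff')
open Literature.MathematicalPhysics.QuantumFieldTheory.Balaban1983to89.T3Thm1Carrier (varProblem3)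
open Literature.MathematicalPhysics.QuantumFieldTheory.Balaban1983to89.T3SectASteps (secTo secTo_mem_fibre)
open Literature.MathematicalPhysics.QuantumFieldTheory.Balaban1983to89.T3DescentFibreTower (expMeanLogSU_E_one)
open Summit.QuantumFields.Balaban3D.Carriers (suGroupModel)
open Summit.QuantumFields.YangMills.Theorems.AbelianEML (gexpAt linAvgIter loopSum)
open Summit.QuantumFields.YangMills.Theorems.Prop7SymCentreAbelianDict (I_smul_sigma3_mem_lie)
open Summit.QuantumFields.YangMills.Theorems.Prop7NestedMeanParallelLiftDiagGauge
  (parallelConstDiag_or_loopHol_central onlyScalar_or_exists_gauge_commute_sigma3 coe_unitsField_toUField coe_inv_unitsField_toUField)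
open Summit.QuantumFields.YangMills.Theorems.Prop7SymCentreCentral (secTo_mem_regFibrePr_of_central)
open Summit.QuantumFields.YangMills.Theorems.Prop7SymCentreCentralGauge (exists_gauge_centralValued_of_loopHol_central)
open Summit.QuantumFields.YangMills.Theorems.Prop7FlatDatum (holFlat_of_plaqHol_eq_one eq_one_of_dist1_le_zero)
open Summit.QuantumFields.YangMills.Theorems.Prop7FlatRigidity (atMostOneCriticalOrbit_of_holFlat_mem_fibre)
open Summit.QuantumFields.YangMills.Theorems.Prop7OrbitTransport (atMostOneCriticalOrbit_gaugeAct)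
open Summit.QuantumFields.YangMills.Theorems.FluctuationComparisonRegPrIntLS2BetaCentralStabOfIrr (atMostOneCriticalOrbit_of_irr_five)
open Summit.QuantumFields.YangMills.Theorems.FluctuationComparisonRegPrIntLS2BetaCriticalOrbitUniqueAbelian (atMostOneCriticalOrbit_of_abelianMin_caseA_five)

namespace Summit.QuantumFields.YangMills.Theorems.FluctuationComparisonRegPrIntLS2BetaCriticalOrbitUniqueOfExab

/-! ## §1 Case B: central loop holonomies — Prop. 7 clause 1 unconditionally -/

section Central

variable (F : T3Family) {n K : ℕ}

/-- **THE BLOCK-CONSTANT SECTION OF A CENTRAL-VALUED `2`-SMALL DATUM IS PLAQUETTE-FLAT**: `secTo S` lies in (6)(a) at EVERY radius `a > 0`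
(✓`secTo_mem_regFibrePr_of_central`), so each plaquette variable is within `a·L^{−2(K−n)}` of `1` for every `a > 0`, i.e. equal to `1`.
[cite: Balaban1985Variational, (2),(6) p.278; Balaban1987RG1, (0.11) p.253] -/
theorem plaqHol_secTo_eq_one_of_central (h : n ≤ K) (S : GaugeField (F.P n) 0 (Matrix.specialUnitaryGroup (Fin 2) ℂ))
    (hcen : ∀ (c : PBond (F.P n) 0) (M : Matrix (Fin 2) (Fin 2) ℂ), Commute ((S c : Matrix.specialUnitaryGroup (Fin 2) ℂ) : Matrix (Fin 2) (Fin 2) ℂ) M)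
    {δ : ℝ} (hδ : δ ≤ 2) (hS : PlaqSmall δ S) (p : Plaq (F.P K) 0) : GaugeField.plaqHol (secTo F n K h S) p = 1 := by
  apply eq_one_of_dist1_le_zero
  refine le_of_forall_pos_le_add fun a ha => ?_
  have hL1 : (1 : ℝ) ≤ (F.L : ℝ) := by exact_mod_cast F.hL.2.le
  have hreg := ((mem_regFibrePr_iff F).mp (secTo_mem_regFibrePr_of_central F h S hcen hδ hS ha)).2
  have hlt := hreg.plaqSmall p
  have hthr : regThreshold F n K a ≤ a := by
    unfold regThreshold
    have hq : ((F.L : ℝ)⁻¹) ^ (2 * (K - n)) ≤ 1 := pow_le_one₀ (inv_nonneg.mpr (by positivity)) (inv_le_one_of_one_le₀ hL1)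
    nlinarith
  linarith

/-- ★★ **PROP. 7 CLAUSE 1 OVER A CENTRAL-VALUED DATUM, UNCONDITIONALLY** (every member, `n < K`, every `ε₀`; `PlaqSmall δ S`, `δ ≤ 2`): the fibre of `S` meets the
holonomy-flat sector at `secTo S` (§1 + lattice Stokes ✓`holFlat_of_plaqHol_eq_one`), so ✓`Prop7FlatRigidity.atMostOneCriticalOrbit_of_holFlat_mem_fibre` applies.
[cite: Balaban1985Variational, Prop. 7 p.299, (4)-(6) p.278; Balaban1985Averaging, (19)-(20) p.21] -/
theorem atMostOneCriticalOrbit_of_centralValued (hnK : n < K) (S : GaugeField (F.P n) 0 (Matrix.specialUnitaryGroup (Fin 2) ℂ))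
    (hcen : ∀ (c : PBond (F.P n) 0) (M : Matrix (Fin 2) (Fin 2) ℂ), Commute ((S c : Matrix.specialUnitaryGroup (Fin 2) ℂ) : Matrix (Fin 2) (Fin 2) ℂ) M)
    {δ : ℝ} (hδ : δ ≤ 2) (hS : PlaqSmall δ S) (ε₀ : ℝ) : (varProblem3 F n K hnK.le).AtMostOneCriticalOrbit ε₀ S :=
  atMostOneCriticalOrbit_of_holFlat_mem_fibre (L := F.L) ⟨(F, n, K), rfl, hnK⟩
    (holFlat_of_plaqHol_eq_one _ (plaqHol_secTo_eq_one_of_central F hnK.le S hcen hδ hS))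
    (secTo_mem_fibre F ℰp expMeanLogSU_E_one hnK.le S) ε₀

/-- ★★★ **PROP. 7 CLAUSE 1 AT EVERY CASE-B DATUM, UNCONDITIONALLY**: if every closed-walk holonomy of `V` at some site `x₀` is central and `PlaqSmall δ V`, `δ ≤ 2`,
then over `V` the variational problem (5), (6) has at most one critical orbit of print's group (4) — at every radius `ε₀`, every member, every `L`.  Z2 normal form
✓`exists_gauge_centralValued_of_loopHol_central` (`V = w • S`, `S` central-valued), the clause at `S` above, transported along `w = (liftTransfTo w)↓`
(✓`atMostOneCriticalOrbit_gaugeAct`). [cite: Balaban1985Variational, Prop. 7 p.299, (4) p.278; Balaban1985Averaging, (9),(11)-(12) p.19] -/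
theorem atMostOneCriticalOrbit_of_loopHol_central (hnK : n < K) (V : GaugeField (F.P n) 0 (Matrix.specialUnitaryGroup (Fin 2) ℂ)) (x₀ : Site (F.P n) 0)
    (hcen : ∀ w : List (Letter (F.P n).d), walkEnd x₀ w = x₀ →
      ∀ M : Matrix (Fin 2) (Fin 2) ℂ, Commute ((holAt V (walk x₀ w) : Matrix.specialUnitaryGroup (Fin 2) ℂ) : Matrix (Fin 2) (Fin 2) ℂ) M)
    {δ : ℝ} (hδ : δ ≤ 2) (hV : PlaqSmall δ V) (ε₀ : ℝ) : (varProblem3 F n K hnK.le).AtMostOneCriticalOrbit ε₀ V := by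
  obtain ⟨w, S, hcenS, hS, rfl⟩ := exists_gauge_centralValued_of_loopHol_central V x₀ hcen hV
  have h := atMostOneCriticalOrbit_gaugeAct F hnK.le (liftTransfTo F n K hnK.le w) ε₀ (atMostOneCriticalOrbit_of_centralValued F hnK S hcenS hδ hS ε₀)
  rwa [descTransf_liftTransfTo] at h

end Central

/-! ## §2 The two «irreducible» letters agree -/

section Irr

variable (F : T3Family) {n : ℕ}

/-- **«ONLY SCALAR PARALLEL SECTIONS» (SYM-CENTRE letters, `c(e₋) = V♭(e)·c(e₊)·V♭(e)⁻¹`) ⇒ IRR(V) ((T7b)'s letters, `s(e₋)·V(e) = V(e)·s(e₊)`).**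
[cite: Balaban1985BackgroundPropagators, (3.21) p.394 (bookkeeping)] -/
theorem irr_of_onlyScalar (V : GaugeField (F.P n) 0 (Matrix.specialUnitaryGroup (Fin 2) ℂ))
    (hIrr : ∀ c : Site (F.P n) 0 → Matrix (Fin 2) (Fin 2) ℂ,
      (∀ e : PBond (F.P n) 0, c e.src = ((unitsField (toUField V) e : (Matrix (Fin 2) (Fin 2) ℂ)ˣ) : Matrix (Fin 2) (Fin 2) ℂ) * c e.tgt *
        (((unitsField (toUField V) e)⁻¹ : (Matrix (Fin 2) (Fin 2) ℂ)ˣ) : Matrix (Fin 2) (Fin 2) ℂ)) →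
      ∃ z : ℂ, ∀ y, c y = z • (1 : Matrix (Fin 2) (Fin 2) ℂ)) :
    ∀ s : Site (F.P n) 0 → Matrix (Fin 2) (Fin 2) ℂ,
      (∀ b : PBond (F.P n) 0, s b.src * (V b : Matrix (Fin 2) (Fin 2) ℂ) = (V b : Matrix (Fin 2) (Fin 2) ℂ) * s b.tgt) →
        ∃ c : ℂ, ∀ x, s x = c • (1 : Matrix (Fin 2) (Fin 2) ℂ) := by
  intro s hs
  refine hIrr s fun e => ?_
  rw [coe_unitsField_toUField, coe_inv_unitsField_toUField]
  have hV : ((V e : Matrix.specialUnitaryGroup (Fin 2) ℂ) : Matrix (Fin 2) (Fin 2) ℂ) * star ((V e : Matrix.specialUnitaryGroup (Fin 2) ℂ) : Matrix (Fin 2) (Fin 2) ℂ) = 1 :=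
    (V e).2.1.2
  calc s e.src = s e.src * (((V e : Matrix.specialUnitaryGroup (Fin 2) ℂ) : Matrix (Fin 2) (Fin 2) ℂ) * star ((V e : Matrix.specialUnitaryGroup (Fin 2) ℂ) : Matrix (Fin 2) (Fin 2) ℂ)) := by
        rw [hV, mul_one]
    _ = (s e.src * ((V e : Matrix.specialUnitaryGroup (Fin 2) ℂ) : Matrix (Fin 2) (Fin 2) ℂ)) * star ((V e : Matrix.specialUnitaryGroup (Fin 2) ℂ) : Matrix (Fin 2) (Fin 2) ℂ) := by
        rw [mul_assoc]
    _ = ((V e : Matrix.specialUnitaryGroup (Fin 2) ℂ) : Matrix (Fin 2) (Fin 2) ℂ) * s e.tgt * star ((V e : Matrix.specialUnitaryGroup (Fin 2) ℂ) : Matrix (Fin 2) (Fin 2) ℂ) := by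
        rw [hs e]

end Irr

/-! ## §3 The master door: Prop. 7 clause 1 at every datum, modulo EX^{ab} at the diagonal representative -/

section Master

/-- ★★★★ **[Balaban1985Variational] PROP. 7 CLAUSE 1 AT EVERY `2`-SMALL DATUM, `L ≥ 5`, MODULO EX^{ab}.**  There is `e₉ > 0` such that for every member `F` (`F.L = L`),
heights `n < K`, every `0 < e ≤ e₉` with the admissibility rows `143·(49∕4)²·e ≤ 1∕3`, `2e ≤ 2δ₂∕(7L)²`, and every datum `V` with `PlaqSmall δ V`, `δ ≤ 2`: IF, for
every coarse gauge `g` such that `g • V` is σ₃-diagonal of case A (all `(g • V)♭`-parallel matrix sections constant diagonal), an ABELIAN CONSTRAINED MINIMISER over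
`g • V` is supplied — a lettering `a` with strict loop-sum guards `3|Σ(linAvgIter s′ a)| < 1` below `K − n`, `e^{a·iσ₃} ∈ regFibrePr F n K e (g • V)` minimising the
Wilson action among the σ₃-diagonal members of `regFibrePr F n K e (g • V)` (EX^{ab}, the ONLY letter) —, THEN `(varProblem3 F n K hnK.le).AtMostOneCriticalOrbit e V`:
any two R2-critical configurations of (6)(e) over `V` lie on one orbit of print's group (4).  Strata: irreducible (✓px21 `atMostOneCriticalOrbit_of_irr_five` ∘ §2),
diagonalisable (✓`onlyScalar_or_exists_gauge_commute_sigma3`) of case B (§1, unconditional) or case A (✓FILE 3 ⟸ EX^{ab}); the clause moves along the diagonalising gauge by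
✓`atMostOneCriticalOrbit_gaugeAct`. [cite: Balaban1985Variational, Prop. 7 p.299, (2)-(7) p.278; Balaban1985BackgroundPropagators, (3.21) p.394; Balaban1985Averaging, (8)-(13) p.19] -/
theorem atMostOneCriticalOrbit_five_of_exab (L : ℕ) (h5 : 5 ≤ L) :
    ∃ e₉ : ℝ, 0 < e₉ ∧ ∀ (F : T3Family), F.L = L → ∀ (n K : ℕ) (hnK : n < K) (e : ℝ) (V : GaugeField (F.P n) 0 (Matrix.specialUnitaryGroup (Fin 2) ℂ)) (δ : ℝ),
      0 < e → e ≤ e₉ → (143 * ((((3 + 4 : ℕ) : ℝ)) ^ 2 / 4) ^ 2) * e ≤ 1 / 3 → 2 * e ≤ 2 * deltaSU (Fin 2) / (((3 + 4) * F.L : ℕ) : ℝ) ^ 2 →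
      δ ≤ 2 → PlaqSmall δ V →
      (∀ g : GaugeTransf (F.P n) 0 (Matrix.specialUnitaryGroup (Fin 2) ℂ),
        (∀ e' : PBond (F.P n) 0, Commute ((GaugeField.gaugeAct g V e' : Matrix.specialUnitaryGroup (Fin 2) ℂ) : Matrix (Fin 2) (Fin 2) ℂ) σ₃) →
        (∀ c : Site (F.P n) 0 → Matrix (Fin 2) (Fin 2) ℂ,
          (∀ e' : PBond (F.P n) 0, c e'.src = ((unitsField (toUField (GaugeField.gaugeAct g V)) e' : (Matrix (Fin 2) (Fin 2) ℂ)ˣ) : Matrix (Fin 2) (Fin 2) ℂ) * c e'.tgt *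
            (((unitsField (toUField (GaugeField.gaugeAct g V)) e')⁻¹ : (Matrix (Fin 2) (Fin 2) ℂ)ˣ) : Matrix (Fin 2) (Fin 2) ℂ)) →
          ∃ c₀ : Matrix (Fin 2) (Fin 2) ℂ, (∀ y, c y = c₀) ∧ Commute c₀ σ₃) →
        ∃ a : PBond (F.P K) 0 → ℝ,
          (∀ s', s' < K - n → ∀ (c : PBond (F.P K) (s' + 1)) (i : Idx (F.P K)), 3 * |loopSum (linAvgIter s' a) c i| < 1) ∧
          gexpAt (suGroupModel 2) I_smul_sigma3_mem_lie a ∈ regFibrePr F n K hnK.le e (GaugeField.gaugeAct g V) ∧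
          ∀ W' : GaugeField (F.P K) 0 (Matrix.specialUnitaryGroup (Fin 2) ℂ),
            (∀ b, Commute ((W' b : Matrix.specialUnitaryGroup (Fin 2) ℂ) : Matrix (Fin 2) (Fin 2) ℂ) σ₃) → W' ∈ regFibrePr F n K hnK.le e (GaugeField.gaugeAct g V) →
              wilsonAction4 (gexpAt (suGroupModel 2) I_smul_sigma3_mem_lie a) ≤ wilsonAction4 W') →
      (varProblem3 F n K hnK.le).AtMostOneCriticalOrbit e V := by
  obtain ⟨e₈, he₈, HI⟩ := atMostOneCriticalOrbit_of_irr_five L h5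
  obtain ⟨e₉, he₉, HA⟩ := atMostOneCriticalOrbit_of_abelianMin_caseA_five L h5
  refine ⟨min e₈ e₉, lt_min he₈ he₉, ?_⟩
  intro F hF n K hnK e V δ he hee hr3 hr2 hδ hV hEX
  have hk : K - n ≤ (F.P K).m + (F.P K).K := by show K - n ≤ F.m + K; omega
  rcases onlyScalar_or_exists_gauge_commute_sigma3 V with hIrr | ⟨g, hdiag⟩
  · -- irreducible datum
    exact HI F hF n K hnK e V he (hee.trans (min_le_left _ _)) (irr_of_onlyScalar F V hIrr)
  · -- diagonalisable datum: work at `V′ := g • V` and transport back along `g = (liftTransfTo g)↓`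
    have hback : (varProblem3 F n K hnK.le).AtMostOneCriticalOrbit e (GaugeField.gaugeAct g V) → (varProblem3 F n K hnK.le).AtMostOneCriticalOrbit e V := by
      intro hV'
      have h1 := atMostOneCriticalOrbit_gaugeAct F hnK.le (liftTransfTo F n K hnK.le fun x => (g x)⁻¹) e hV'
      rw [descTransf_liftTransfTo] at h1
      have hVV : GaugeField.gaugeAct (fun x => (g x)⁻¹) (GaugeField.gaugeAct g V) = V := by
        funext b
        show (g b.src)⁻¹ * (g b.src * V b * (g b.tgt)⁻¹) * ((g b.tgt)⁻¹)⁻¹ = V b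
        rw [inv_inv, ← mul_assoc, ← mul_assoc, inv_mul_cancel, one_mul, mul_assoc, inv_mul_cancel, mul_one]
      rwa [hVV] at h1
    rcases parallelConstDiag_or_loopHol_central (GaugeField.gaugeAct g V) hdiag with hA | ⟨y₀, hcenB⟩
    · -- case A: the abelian letter
      obtain ⟨a, hloop, hreg, hmin⟩ := hEX g hdiag hA
      exact hback (HA F hF n K hnK hk e (GaugeField.gaugeAct g V) a he (hee.trans (min_le_right _ _)) hr3 hr2 hA hloop hreg hmin)
    · -- case B: unconditional
      exact hback (atMostOneCriticalOrbit_of_loopHol_central F hnK (GaugeField.gaugeAct g V) y₀ hcenB hδ ((plaqSmall_gaugeAct_iff' δ g V).mpr hV) e)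

end Master

end Summit.QuantumFields.YangMills.Theorems.FluctuationComparisonRegPrIntLS2BetaCriticalOrbitUniqueOfExab

end
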